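import Summits.RiemannHypothesis.RiemannHypothesis.Theorems.TiltedLandingLaw421R3Lens1Coverage

/-! # Lens-1 COVERAGE THEOREM (file A2 of 4: §6–§8) — see file A1 for full header -/

namespace RhW08.Lens1Coverage

set_option linter.dupNamespace false

open Complex Set
open scoped ComplexConjugate
open Literature.Analysis.Complex
open Summit.RiemannHypothesis.RiemannHypothesis.Theorems.Splittings.JensenWindow
open RhIdea6.G17.W07C7 RhIdea6.G17.W07C7.Rev6 RhIdea6.G18.W07C8.Law421BirthS RhIdea6.G19.W07C11.Seam
open RhIdea6.G20.W07C12.Frac RhIdea6.G20.W07C12.StColP RhW07.C12.FieldSplit RhIdea6.G21.W07C13.TentMax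
open RhW07.C14.TwoSided RhW07.C14.Classes RhW07.C14.Lineage RhW07.C14.Booking
open RhW07.C13.Heredity RhIdea6.G22.W07C15pre.Injection RhW07.E3.Cell RhW07.E3.Lit
open RhW08.Round1 RhW08.StSwap RhW08.Round2 RhW08.QuadW RhW08.SealSwapQ RhW08.SealSwap RhW08.SuccB RhW08.SuccSplit
open RhW08.SuccTheft RhW08.Column RhW08.Hurwitz RhW08.ClusterQ RhW08.ClusterQM RhW08.NewtonDoor RhW08.NewtonDoorGenusOne RhW08.PurseP
open RhW08.AntiEscapeSplit7

/-! ## §6 REGIME OBSERVABLES and the typed regime boundaries (director CA440: «which regime boundary does the idea control»)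

Two dimensionless numbers of the tracked state `v` (with `y = Im v`, `K = newtonK f j v`):
* the COVER INDEX `ι := y·Im K + ½` — by `newtonChild_mem_disc_iff`, `ι ≤ 0` iff the Newton centre `v − K⁻¹` lies in `v`'s closed
  Jensen disc; by `pairField_im_pos_iff` only a COVERING pair contributes positively to it;
* the FIELD STRENGTH `κ := ‖K‖·y` — door N's regime clause is `1 < κ`.
Boundaries proved below: (B1) the Jensen clause of N♯ with margin `ρ₀` is EXACTLY `ρ₀ ≤ κ ∧ 2ι ≤ ρ₀² − 2ρ₀κ`; (B2) weak field forces
cover: `κ < ½ → 0 < ι` (so an un-covered state always has `κ ≥ ½`: the weak-field regime of U/L is a sub-regime of COVERED). -/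

/-- ι, the cover index. -/
noncomputable def coverIndex (f : ℂ → ℂ) (j : ℕ) (v : ℂ) : ℝ := v.im * (newtonK f j v).im + 1 / 2

/-- κ, the field strength in units of `1/Im v`. -/
noncomputable def fieldStrength (f : ℂ → ℂ) (j : ℕ) (v : ℂ) : ℝ := ‖newtonK f j v‖ * v.im

/-- Exact size of the Newton displacement seen from the Jensen-disc centre: `‖(v − K⁻¹) − Re v‖²·‖K‖² = y²‖K‖² + (1 + 2y·Im K)`. -/
theorem normSq_newtonCentre_mul (v : ℂ) {K : ℂ} (hK : K ≠ 0) :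
    ‖(v - K⁻¹) - (v.re : ℂ)‖ ^ 2 * ‖K‖ ^ 2 = v.im ^ 2 * ‖K‖ ^ 2 + (1 + 2 * v.im * K.im) := by
  have hn : 0 < Complex.normSq K := Complex.normSq_pos.mpr hK
  have hexpr : (v - K⁻¹) - (v.re : ℂ) = (v.im : ℂ) * I - K⁻¹ := Complex.ext (by simp) (by simp)
  rw [hexpr]
  have hre : ((v.im : ℂ) * I - K⁻¹).re = -(K.re / Complex.normSq K) := by
    simp [Complex.sub_re, Complex.mul_re, Complex.inv_re]
  have him : ((v.im : ℂ) * I - K⁻¹).im = v.im + K.im / Complex.normSq K := by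
    simp [Complex.sub_im, Complex.mul_im, Complex.inv_im]
    ring
  have key : Complex.normSq ((v.im : ℂ) * I - K⁻¹) * Complex.normSq K
      = v.im ^ 2 * Complex.normSq K + (1 + 2 * v.im * K.im) := by
    have hnK : Complex.normSq K = K.re * K.re + K.im * K.im := Complex.normSq_apply K
    rw [Complex.normSq_apply ((v.im : ℂ) * I - K⁻¹), hre, him]
    field_simp
    rw [hnK]; ring
  rw [← Complex.normSq_eq_norm_sq, ← Complex.normSq_eq_norm_sq]
  exact key

/-- (B1) THE N♯ ⁄ GRAZING BOUNDARY, exactly: the Jensen clause of `NewtonNumbersSharpWith` with margin `ρ₀/‖K‖` holds iff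
`ρ₀ ≤ κ` and `2ι ≤ ρ₀² − 2ρ₀κ` (`ι = y·Im K + ½`, `κ = ‖K‖·y`). -/
theorem jensenClause_iff {v K : ℂ} (hK : K ≠ 0) (ρ₀ : ℝ) :
    ‖(v - K⁻¹) - (v.re : ℂ)‖ + ρ₀ / ‖K‖ ≤ v.im ↔
      ρ₀ ≤ ‖K‖ * v.im ∧ 1 + 2 * v.im * K.im ≤ ρ₀ ^ 2 - 2 * ρ₀ * (‖K‖ * v.im) := by
  have hnK : 0 < ‖K‖ := norm_pos_iff.mpr hK
  have key := normSq_newtonCentre_mul v hK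
  set A := ‖(v - K⁻¹) - (v.re : ℂ)‖ with hA
  have hA0 : 0 ≤ A := norm_nonneg _
  constructor
  · intro h
    have h1 : ρ₀ ≤ ‖K‖ * v.im := by
      have : ρ₀ / ‖K‖ ≤ v.im := by linarith
      rwa [div_le_iff₀ hnK, mul_comm] at this
    refine ⟨h1, ?_⟩
    have h2 : A * ‖K‖ ≤ ‖K‖ * v.im - ρ₀ := by
      have : A ≤ v.im - ρ₀ / ‖K‖ := by linarith
      have := mul_le_mul_of_nonneg_right this hnK.le
      rwa [sub_mul, div_mul_cancel₀ _ hnK.ne', mul_comm v.im] at this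
    have h3 : (A * ‖K‖) ^ 2 ≤ (‖K‖ * v.im - ρ₀) ^ 2 :=
      pow_le_pow_left₀ (mul_nonneg hA0 hnK.le) h2 2
    nlinarith [key, h3]
  · rintro ⟨h1, h2⟩
    have h3 : (A * ‖K‖) ^ 2 ≤ (‖K‖ * v.im - ρ₀) ^ 2 := by nlinarith [key]
    have h4 : A * ‖K‖ ≤ ‖K‖ * v.im - ρ₀ := by
      have hb : 0 ≤ ‖K‖ * v.im - ρ₀ := by linarith
      exact (pow_le_pow_iff_left₀ (mul_nonneg hA0 hnK.le) hb two_ne_zero).mp h3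
    have h5 : ρ₀ / ‖K‖ ≤ v.im - A := by
      rw [div_le_iff₀ hnK]
      nlinarith
    linarith

/-- (B1′) the same boundary in the observables `ι = coverIndex`, `κ = fieldStrength`, for `K = newtonK f j v`. -/
theorem jensenClause_iff_coverIndex {f : ℂ → ℂ} {j : ℕ} {v : ℂ} (hK : newtonK f j v ≠ 0) (ρ₀ : ℝ) :
    ‖(v - (newtonK f j v)⁻¹) - (v.re : ℂ)‖ + ρ₀ / ‖newtonK f j v‖ ≤ v.im ↔
      ρ₀ ≤ fieldStrength f j v ∧ 2 * coverIndex f j v ≤ ρ₀ ^ 2 - 2 * ρ₀ * fieldStrength f j v := by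
  rw [jensenClause_iff hK ρ₀]
  unfold fieldStrength coverIndex
  constructor <;> rintro ⟨h1, h2⟩ <;> exact ⟨h1, by linarith⟩

/-- (B2) WEAK FIELD FORCES COVER: `κ < ½ → 0 < ι` (`|Im K| ≤ ‖K‖`).  Contrapositive: an un-covered state (`ι ≤ 0`) has `κ ≥ ½`. -/
theorem coverIndex_pos_of_weak {f : ℂ → ℂ} {j : ℕ} {v : ℂ} (hv : 0 < v.im) (hκ : fieldStrength f j v < 1 / 2) :
    0 < coverIndex f j v := by
  unfold fieldStrength at hκ
  unfold coverIndex
  have h1 : |(newtonK f j v).im| ≤ ‖newtonK f j v‖ := Complex.abs_im_le_norm _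
  have h2 : -(‖newtonK f j v‖ * v.im) ≤ v.im * (newtonK f j v).im := by
    have := neg_abs_le (newtonK f j v).im
    nlinarith
  linarith

/-- (B2) Weak field forces cover: if `ι ≤ 0` (un-covered), then `κ ≥ ½`. -/
theorem half_le_fieldStrength_of_uncovered {f : ℂ → ℂ} {j : ℕ} {v : ℂ} (hv : 0 < v.im) (hι : coverIndex f j v ≤ 0) :
    1 / 2 ≤ fieldStrength f j v := by
  by_contra h
  push Not at h
  exact absurd hι (not_le.mpr (coverIndex_pos_of_weak hv h))

/-- (B3) door N♯'s AVAILABILITY REGION in the coordinates `(ι, κ)` — `ρ₀ ≤ κ`, `2ι ≤ ρ₀² − 2ρ₀κ` (Jensen margin, (B1)),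
`ρ₀κ ≤ κ² + ι − ½` (off-axis clause N3: the child's height is `y(κ² + ι − ½)/κ²`) — plus the two zero-configuration clauses
(separation, END number) verbatim.  PROVED repackaging: these five give `NewtonNumbersSharp`, hence a successor. -/
theorem newtonNumbersSharp_of_coordinates {f : ℂ → ℂ} {j : ℕ} {v : ℂ} (hv : 0 < v.im) (hK0 : newtonK f j v ≠ 0)
    {ρ₀ δ : ℝ} (hρ₀ : 0 < ρ₀) (hδ : 0 < δ)
    (hρκ : ρ₀ ≤ fieldStrength f j v)
    (hmargin : 2 * coverIndex f j v ≤ ρ₀ ^ 2 - 2 * ρ₀ * fieldStrength f j v)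
    (hoff : ρ₀ * fieldStrength f j v ≤ fieldStrength f j v ^ 2 + coverIndex f j v - 1 / 2)
    (hsep : ∀ c, dslope (iteratedDeriv j f) v c = 0 → (1 + ρ₀) / ‖newtonK f j v‖ + δ ≤ ‖v - c‖)
    (hend : (1 + ρ₀) * ((1 + ρ₀) / ‖newtonK f j v‖ *
        ∑' c, (analyticOrderNatAt (dslope (iteratedDeriv j f) v) c : ℝ) / ((‖v - c‖ - (1 + ρ₀) / ‖newtonK f j v‖) * ‖v - c‖))
        < ρ₀ * ‖newtonK f j v‖) :
    NewtonNumbersSharp f j v := by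
  have hnK : 0 < ‖newtonK f j v‖ := norm_pos_iff.mpr hK0
  refine ⟨ρ₀, δ, hK0, hρ₀, ?_, hδ, hsep, hend, (jensenClause_iff_coverIndex hK0 ρ₀).mpr ⟨hρκ, hmargin⟩⟩
  have him : (v - (newtonK f j v)⁻¹).im = v.im + (newtonK f j v).im / ‖newtonK f j v‖ ^ 2 := by
    rw [Complex.sub_im, Complex.inv_im, Complex.normSq_eq_norm_sq]; ring
  unfold fieldStrength coverIndex at hoff
  have hKy : 0 < ‖newtonK f j v‖ * v.im := mul_pos hnK hv
  have h2 : ρ₀ ≤ ‖newtonK f j v‖ * v.im + (newtonK f j v).im / ‖newtonK f j v‖ := by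
    have h3 : ρ₀ * (‖newtonK f j v‖ * v.im)
        ≤ (‖newtonK f j v‖ * v.im + (newtonK f j v).im / ‖newtonK f j v‖) * (‖newtonK f j v‖ * v.im) := by
      have : (‖newtonK f j v‖ * v.im + (newtonK f j v).im / ‖newtonK f j v‖) * (‖newtonK f j v‖ * v.im)
          = (‖newtonK f j v‖ * v.im) ^ 2 + v.im * (newtonK f j v).im := by
        field_simp
      rw [this]; linarith
    exact le_of_mul_le_mul_right h3 hKy
  have h1 : ρ₀ / ‖newtonK f j v‖ ≤ v.im + (newtonK f j v).im / ‖newtonK f j v‖ ^ 2 := by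
    rw [div_le_iff₀ hnK]
    have : (v.im + (newtonK f j v).im / ‖newtonK f j v‖ ^ 2) * ‖newtonK f j v‖
        = ‖newtonK f j v‖ * v.im + (newtonK f j v).im / ‖newtonK f j v‖ := by
      field_simp
    rw [this]; exact h2
  rw [him]
  exact h1.trans (le_abs_self _)

/-- (B4) the CHILD'S HEIGHT in coordinates: `Im(v − K⁻¹) = y·(κ² + ι − ½)/κ²` — it vanishes on the LANDING CURVE `ι = ½ − κ²`
(door L's territory) and equals `−y` at the ISOLATED-PAIR corner `(κ, ι) = (½, 0)` (no external field: the child is the mirror). -/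
theorem newtonChild_im {f : ℂ → ℂ} {j : ℕ} {v : ℂ} (hv : 0 < v.im) (hK0 : newtonK f j v ≠ 0) :
    (v - (newtonK f j v)⁻¹).im * fieldStrength f j v ^ 2
      = v.im * (fieldStrength f j v ^ 2 + coverIndex f j v - 1 / 2) := by
  have hnK : 0 < ‖newtonK f j v‖ := norm_pos_iff.mpr hK0
  unfold fieldStrength coverIndex
  rw [Complex.sub_im, Complex.inv_im, Complex.normSq_eq_norm_sq]
  field_simp
  ring

/-! ## §7 DOOR N♭ — the band slack CHARGED AT THE CHILD with its SIGNED height (the cheapest cash-out of the sign reading)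

Door N's scalar slack N5 charges the height at `Im v + (1+ρ₀)/‖K‖` — the sign of the vertical displacement `Im K/‖K‖²` is thrown
away.  N♭ keeps N's engine and N's frame but charges the band inequality at the Newton disc's worst corner:
`(max (|Re(v − K⁻¹) − x₀| + ρ₀/‖K‖ − R/2) 0)² + (j+1)·(|Im(v − K⁻¹)| + ρ₀/‖K‖)² ≤ (j+1)·Hs²`.
For an un-covered state (`ι ≤ 0`) the child is LOWER than `v` by `y(½ − ι)/κ²` ((B4)), so at the strip top (C6's R0 cells, `Im v = Hs`,
where N5 is infeasible for every ρ₀ and N♯'s window is `ρ₀ ≤ |ι|/κ ≈ 0.05–0.11`, instr-1 PRICE-lens1-v1) N♭'s window is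
`h₀ ≲ ρ₀ ≤ (½ − ι)/κ` (≈ 0.2 on those rows) — prediction K-A♭ below. -/

/-- FRAME socket for N♭: N♯'s first six clauses verbatim, the seventh = band slack at the child's worst corner. -/
def NewtonNumbersChildWith (f : ℂ → ℂ) (x₀ R Hs : ℝ) (j : ℕ) (v K : ℂ) (ρ₀ δ : ℝ) : Prop :=
  K ≠ 0 ∧ 0 < ρ₀ ∧ ρ₀ / ‖K‖ ≤ |(v - K⁻¹).im| ∧ 0 < δ ∧
  (∀ c : ℂ, dslope (iteratedDeriv j f) v c = 0 → (1 + ρ₀) / ‖K‖ + δ ≤ ‖v - c‖) ∧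
  (1 + ρ₀) * ((1 + ρ₀) / ‖K‖ *
      ∑' c : ℂ, (analyticOrderNatAt (dslope (iteratedDeriv j f) v) c : ℝ) / ((‖v - c‖ - (1 + ρ₀) / ‖K‖) * ‖v - c‖))
    < ρ₀ * ‖K‖ ∧
  (max (|(v - K⁻¹).re - x₀| + ρ₀ / ‖K‖ - R / 2) 0) ^ 2 + ((j : ℝ) + 1) * (|(v - K⁻¹).im| + ρ₀ / ‖K‖) ^ 2
    ≤ ((j : ℝ) + 1) * Hs ^ 2

/-- DOOR N♭'s numbers at `(j, v)`: some `(ρ₀, δ)` with `K = newtonK f j v`. -/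
def NewtonNumbersChild (f : ℂ → ℂ) (x₀ R Hs : ℝ) (j : ℕ) (v : ℂ) : Prop :=
  ∃ ρ₀ δ : ℝ, NewtonNumbersChildWith f x₀ R Hs j v (newtonK f j v) ρ₀ δ

/-- The child-charged corner slack gives the whole-disc band clause (monotonicity of the band inequality in `|Re z − x₀|`, `|Im z|`). -/
theorem hdisc_of_childSlack {x₀ R Hs : ℝ} {j : ℕ} {c₀ : ℂ} {r : ℝ}
    (hS : (max (|c₀.re - x₀| + r - R / 2) 0) ^ 2 + ((j : ℝ) + 1) * (|c₀.im| + r) ^ 2 ≤ ((j : ℝ) + 1) * Hs ^ 2) :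
    ∀ z : ℂ, ‖z - c₀‖ < r → |z.im| ≤ Hs →
      (max (|z.re - x₀| - R / 2) 0) ^ 2 + ((j : ℝ) + 1) * z.im ^ 2 ≤ ((j : ℝ) + 1) * Hs ^ 2 := by
  intro z hz _
  have hre : |(z - c₀).re| ≤ ‖z - c₀‖ := Complex.abs_re_le_norm _
  have him : |(z - c₀).im| ≤ ‖z - c₀‖ := Complex.abs_im_le_norm _
  rw [Complex.sub_re] at hre
  rw [Complex.sub_im] at him
  have h1 : |z.re - x₀| ≤ |c₀.re - x₀| + r := by
    have h' : |z.re - c₀.re| ≤ r := by linarith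
    calc |z.re - x₀| = |(z.re - c₀.re) + (c₀.re - x₀)| := by ring_nf
      _ ≤ |z.re - c₀.re| + |c₀.re - x₀| := abs_add_le _ _
      _ ≤ |c₀.re - x₀| + r := by linarith
  have h2 : |z.im| ≤ |c₀.im| + r := by
    calc |z.im| = |(z.im - c₀.im) + c₀.im| := by ring_nf
      _ ≤ |z.im - c₀.im| + |c₀.im| := abs_add_le _ _
      _ ≤ |c₀.im| + r := by linarith
  have hA : max (|z.re - x₀| - R / 2) 0 ≤ max (|c₀.re - x₀| + r - R / 2) 0 :=
    max_le_max (by linarith) le_rfl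
  have hA0 : 0 ≤ max (|z.re - x₀| - R / 2) 0 := le_max_right _ _
  have hA2 : (max (|z.re - x₀| - R / 2) 0) ^ 2 ≤ (max (|c₀.re - x₀| + r - R / 2) 0) ^ 2 := pow_le_pow_left₀ hA0 hA 2
  have hB2 : z.im ^ 2 ≤ (|c₀.im| + r) ^ 2 := by
    calc z.im ^ 2 = |z.im| ^ 2 := (sq_abs _).symm
      _ ≤ (|c₀.im| + r) ^ 2 := pow_le_pow_left₀ (abs_nonneg _) h2 2
  have hj : (0 : ℝ) ≤ (j : ℝ) + 1 := by positivity
  nlinarith [mul_le_mul_of_nonneg_left hB2 hj]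

/-- ★★ DOOR N♭: a legal frame, a band state `v`, and child-charged Newton numbers ⇒ the successor state.  No `1 < ‖K‖·Im v`. -/
theorem succ_of_newtonNumbersChild {η : ℝ} {f : ℂ → ℂ} {x₀ s hmax R Hs : ℝ} {B j : ℕ} {v : ℂ}
    (hE : EngineHyps5 2 η f x₀ s hmax R Hs B) (hv : StTrkDQ η f x₀ s hmax R Hs B j v) (hN : NewtonNumbersChild f x₀ R Hs j v) :
    ∃ u : ℂ, StTrkDQ η f x₀ s hmax R Hs B (j + 1) u := by
  by_cases hz : iteratedDeriv (j + 1) f v = 0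
  · exact succ_of_multiple hE hv hz
  obtain ⟨ρ₀, δ, hK, hρ₀, hoff, hδ, hsepZ, hendZ, hS⟩ := hN
  have hf : Summit.RiemannHypothesis.RiemannHypothesis.Theorems.Splittings.JensenWindow.RealEntireLt2 f :=
    realEntireLt2_of_hyps hE
  obtain ⟨ρ, C, hρ0, hρ, hgr⟩ := hf.growth
  obtain ⟨ρ', C', -, hρ', hgr'⟩ := Literature.Analysis.Complex.exists_growth_iteratedDeriv hf.diff hρ0 hρ hgr j
  have hFd : Differentiable ℂ (iteratedDeriv j f) := differentiable_iteratedDeriv_of_entire hE.1 j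
  have hv' : StColQ' η f x₀ s hmax R Hs B j v := hv
  obtain ⟨-, hFv, -⟩ := hv'
  have hderiv : deriv (iteratedDeriv j f) v ≠ 0 := by
    rw [← iteratedDeriv_succ]; exact hz
  have hsimple : analyticOrderAt (iteratedDeriv j f) v = 1 :=
    (hFd.analyticAt v).analyticOrderAt_eq_one_of_zero_deriv_ne_zero hFv hderiv
  exact succ_of_newton_door_genusOne_disc hE hv hFd hgr' hρ' hFv hsimple rfl hK hρ₀ hoff hδ hsepZ hendZ
    (hdisc_of_childSlack hS)

/-- (B6) N♭'s HEIGHT clause in coordinates for an un-covered-below-the-axis-safe state: when the child is in the upper half-plane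
(`κ² + ι − ½ ≥ 0`), `|Im(v − K⁻¹)| + ρ₀/‖K‖ ≤ Hs` iff `y·(κ² + ι − ½) + ρ₀·y·κ ≤ Hs·κ²` — at the strip top `y = Hs` this is
`ρ₀ ≤ (½ − ι)/κ`, against N♯'s `ρ₀ ≲ |ι|/κ` and N5's `∅`. -/
theorem childHeight_le_iff {f : ℂ → ℂ} {j : ℕ} {v : ℂ} (hv : 0 < v.im) (hK0 : newtonK f j v ≠ 0) {ρ₀ Hs : ℝ}
    (hup : 0 ≤ fieldStrength f j v ^ 2 + coverIndex f j v - 1 / 2) :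
    |(v - (newtonK f j v)⁻¹).im| + ρ₀ / ‖newtonK f j v‖ ≤ Hs ↔
      v.im * (fieldStrength f j v ^ 2 + coverIndex f j v - 1 / 2) + ρ₀ * v.im * fieldStrength f j v
        ≤ Hs * fieldStrength f j v ^ 2 := by
  have hnK : 0 < ‖newtonK f j v‖ := norm_pos_iff.mpr hK0
  have hκ : 0 < fieldStrength f j v := by unfold fieldStrength; positivity
  have hh := newtonChild_im hv hK0   -- Im(child)·κ² = y·(κ²+ι−½)
  have hκ2 : 0 < fieldStrength f j v ^ 2 := by positivity
  have him0 : 0 ≤ (v - (newtonK f j v)⁻¹).im := by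
    by_contra hc
    push Not at hc
    have h1 : (v - (newtonK f j v)⁻¹).im * fieldStrength f j v ^ 2 < 0 := mul_neg_of_neg_of_pos hc hκ2
    rw [hh] at h1
    have h2 : 0 ≤ v.im * (fieldStrength f j v ^ 2 + coverIndex f j v - 1 / 2) := mul_nonneg hv.le hup
    linarith
  rw [abs_of_nonneg him0]
  have hρ : ρ₀ / ‖newtonK f j v‖ * fieldStrength f j v ^ 2 = ρ₀ * v.im * fieldStrength f j v := by
    unfold fieldStrength
    field_simp
  have key : ((v - (newtonK f j v)⁻¹).im + ρ₀ / ‖newtonK f j v‖) * fieldStrength f j v ^ 2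
      = v.im * (fieldStrength f j v ^ 2 + coverIndex f j v - 1 / 2) + ρ₀ * v.im * fieldStrength f j v := by
    rw [add_mul, hh, hρ]
  constructor
  · intro h
    have := mul_le_mul_of_nonneg_right h hκ2.le
    rw [key] at this
    exact this
  · intro h
    rw [← key] at h
    exact le_of_mul_le_mul_right h hκ2

/-! ## §8 (E1) the END number under SEPARATION: far zeros ⇒ the END sum is at most `2·S₂` ⇒ piece F with honest constants

With `g := dslope (f^{(j)}) v` (zeros = the other zeros of `f^{(j)}`, multiplicity `ord`), `r := (1+ρ₀)/‖K‖`: if every zero `c` of `g` has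
`‖v − c‖ ≥ 2r` then `Σ' ord(c)/((‖v−c‖ − r)‖v−c‖) ≤ 2·Σ' ord(c)/‖v−c‖² =: 2S₂`, so END holds as soon as `2(1+ρ₀)²·S₂ < ρ₀‖K‖²`
(in coordinates: `2(1+ρ₀)²·S₂y² < ρ₀κ²`).  Together with (B3): UN-COVERED-with-margin ∧ FAR ∧ LIGHT ⇒ N♯ ⇒ successor — PROVED. -/

/-- The analytic order at a non-zero point is zero. -/
theorem analyticOrderNatAt_eq_zero_of_ne {g : ℂ → ℂ} (hg : Differentiable ℂ g) {c : ℂ} (hc : g c ≠ 0) :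
    analyticOrderNatAt g c = 0 := by
  have ha : AnalyticAt ℂ g c := hg.analyticAt c
  unfold analyticOrderNatAt
  rw [ha.analyticOrderAt_eq_zero.mpr hc]
  rfl

/-- (E1) termwise-to-sum: separation `2r` turns the END sum into `≤ 2·S₂`. -/
theorem endSum_le_two_S2 {g : ℂ → ℂ} (hg : Differentiable ℂ g) {v : ℂ} {r : ℝ} (hr : 0 < r)
    (hsep : ∀ c : ℂ, g c = 0 → 2 * r ≤ ‖v - c‖)
    (hS : Summable (fun c : ℂ => (analyticOrderNatAt g c : ℝ) / ‖v - c‖ ^ 2)) :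
    ∑' c : ℂ, (analyticOrderNatAt g c : ℝ) / ((‖v - c‖ - r) * ‖v - c‖)
      ≤ 2 * ∑' c : ℂ, (analyticOrderNatAt g c : ℝ) / ‖v - c‖ ^ 2 := by
  have hterm : ∀ c : ℂ, (analyticOrderNatAt g c : ℝ) / ((‖v - c‖ - r) * ‖v - c‖)
      ≤ 2 * ((analyticOrderNatAt g c : ℝ) / ‖v - c‖ ^ 2) := by
    intro c
    by_cases hc : g c = 0
    · have hd : 2 * r ≤ ‖v - c‖ := hsep c hc
      have hd0 : 0 < ‖v - c‖ := by linarith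
      have hdr : ‖v - c‖ / 2 ≤ ‖v - c‖ - r := by linarith
      have hdr0 : 0 < ‖v - c‖ - r := by linarith
      have hn : (0 : ℝ) ≤ (analyticOrderNatAt g c : ℝ) := by positivity
      rw [div_le_iff₀ (mul_pos hdr0 hd0)]
      have : 2 * ((analyticOrderNatAt g c : ℝ) / ‖v - c‖ ^ 2) * ((‖v - c‖ - r) * ‖v - c‖)
          = (analyticOrderNatAt g c : ℝ) * (2 * (‖v - c‖ - r) / ‖v - c‖) := by
        field_simp
      rw [this]
      have h2 : 1 ≤ 2 * (‖v - c‖ - r) / ‖v - c‖ := by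
        rw [le_div_iff₀ hd0]; linarith
      nlinarith
    · rw [analyticOrderNatAt_eq_zero_of_ne hg hc]
      simp
  have hnn : ∀ c : ℂ, 0 ≤ (analyticOrderNatAt g c : ℝ) / ((‖v - c‖ - r) * ‖v - c‖) := by
    intro c
    by_cases hc : g c = 0
    · have hd : 2 * r ≤ ‖v - c‖ := hsep c hc
      have hdr0 : 0 < ‖v - c‖ - r := by linarith
      have hd0 : 0 < ‖v - c‖ := by linarith
      positivity
    · rw [analyticOrderNatAt_eq_zero_of_ne hg hc]
      simp
  have hS2 : Summable (fun c : ℂ => 2 * ((analyticOrderNatAt g c : ℝ) / ‖v - c‖ ^ 2)) := hS.mul_left 2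
  have hS1 : Summable (fun c : ℂ => (analyticOrderNatAt g c : ℝ) / ((‖v - c‖ - r) * ‖v - c‖)) :=
    Summable.of_nonneg_of_le hnn hterm hS2
  calc ∑' c : ℂ, (analyticOrderNatAt g c : ℝ) / ((‖v - c‖ - r) * ‖v - c‖)
      ≤ ∑' c : ℂ, 2 * ((analyticOrderNatAt g c : ℝ) / ‖v - c‖ ^ 2) := hS1.tsum_le_tsum hterm hS2
    _ = 2 * ∑' c : ℂ, (analyticOrderNatAt g c : ℝ) / ‖v - c‖ ^ 2 := tsum_mul_left

/-- ★ (B3+E1) PIECE F PROVED: an un-covered state with Jensen margin `ρ₀`, off-axis room, every other zero at distance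
`≥ 2(1+ρ₀)/‖K‖ + δ`, and LIGHT far field `2(1+ρ₀)²·S₂ < ρ₀‖K‖²` has Newton numbers♯, hence a successor. -/
theorem newtonNumbersSharp_of_far {f : ℂ → ℂ} (hf : Differentiable ℂ f) {j : ℕ} {v : ℂ} (hv : 0 < v.im)
    (hK0 : newtonK f j v ≠ 0) {ρ₀ δ : ℝ} (hρ₀ : 0 < ρ₀) (hδ : 0 < δ)
    (hρκ : ρ₀ ≤ fieldStrength f j v)
    (hmargin : 2 * coverIndex f j v ≤ ρ₀ ^ 2 - 2 * ρ₀ * fieldStrength f j v)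
    (hoff : ρ₀ * fieldStrength f j v ≤ fieldStrength f j v ^ 2 + coverIndex f j v - 1 / 2)
    (hsep2 : ∀ c, dslope (iteratedDeriv j f) v c = 0 → 2 * ((1 + ρ₀) / ‖newtonK f j v‖) + δ ≤ ‖v - c‖)
    (hS : Summable (fun c : ℂ => (analyticOrderNatAt (dslope (iteratedDeriv j f) v) c : ℝ) / ‖v - c‖ ^ 2))
    (hlight : 2 * (1 + ρ₀) ^ 2 * ∑' c : ℂ, (analyticOrderNatAt (dslope (iteratedDeriv j f) v) c : ℝ) / ‖v - c‖ ^ 2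
        < ρ₀ * ‖newtonK f j v‖ ^ 2) :
    NewtonNumbersSharp f j v := by
  have hnK : 0 < ‖newtonK f j v‖ := norm_pos_iff.mpr hK0
  have hG : Differentiable ℂ (iteratedDeriv j f) := by
    have := hf.contDiff (n := ⊤)
    exact (this.differentiable_iteratedDeriv j (WithTop.coe_lt_top _))
  have hg : Differentiable ℂ (dslope (iteratedDeriv j f) v) :=
    Literature.NumberTheory.LFunctions.BurnolVectors.differentiable_dslope hG v
  have hr : 0 < (1 + ρ₀) / ‖newtonK f j v‖ := by positivity
  have hsep : ∀ c, dslope (iteratedDeriv j f) v c = 0 → (1 + ρ₀) / ‖newtonK f j v‖ + δ ≤ ‖v - c‖ := by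
    intro c hc
    have := hsep2 c hc
    linarith
  have hsep' : ∀ c, dslope (iteratedDeriv j f) v c = 0 → 2 * ((1 + ρ₀) / ‖newtonK f j v‖) ≤ ‖v - c‖ := by
    intro c hc
    have := hsep2 c hc
    linarith
  have hE1 := endSum_le_two_S2 hg hr hsep' hS
  refine newtonNumbersSharp_of_coordinates hv hK0 hρ₀ hδ hρκ hmargin hoff hsep ?_
  set T := ∑' c : ℂ, (analyticOrderNatAt (dslope (iteratedDeriv j f) v) c : ℝ) /
      ((‖v - c‖ - (1 + ρ₀) / ‖newtonK f j v‖) * ‖v - c‖) with hT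
  set S₂ := ∑' c : ℂ, (analyticOrderNatAt (dslope (iteratedDeriv j f) v) c : ℝ) / ‖v - c‖ ^ 2 with hS₂
  have h1 : (1 + ρ₀) * ((1 + ρ₀) / ‖newtonK f j v‖ * T) ≤ (1 + ρ₀) * ((1 + ρ₀) / ‖newtonK f j v‖ * (2 * S₂)) := by
    have h1ρ : 0 ≤ 1 + ρ₀ := by linarith
    exact mul_le_mul_of_nonneg_left (mul_le_mul_of_nonneg_left hE1 hr.le) h1ρ
  have h2 : (1 + ρ₀) * ((1 + ρ₀) / ‖newtonK f j v‖ * (2 * S₂)) < ρ₀ * ‖newtonK f j v‖ := by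
    rw [show (1 + ρ₀) * ((1 + ρ₀) / ‖newtonK f j v‖ * (2 * S₂)) = (2 * (1 + ρ₀) ^ 2 * S₂) / ‖newtonK f j v‖ by
      field_simp]
    rw [div_lt_iff₀ hnK]
    nlinarith [hlight]
  exact lt_of_le_of_lt h1 h2


end RhW08.Lens1Coverage
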